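import Literature.Probability.Percolation.KhSThreeDisorderObservable
import HarnessLib

/-!
# Rotating the marks of a `k`-marked discrete domain (re-basing the boundary cycle at the second mark)

Topic `Literature/Probability/Percolation`; lane pcv-sawmu (CriticalPhenomena), five-point / three-disorder lineage. Bollobás–Riordan's
`k`-marked discrete domains (`TriMarkedDomain k`, `TriDiscreteDomain.lean`) carry their marks as positions `0 = pos 0 < pos 1 < ⋯` along the
anticlockwise boundary cycle from the base dart = the first marked dart. The cyclic symmetry `i ↦ i + 1` of the marks is therefore not
definitional: this file constructs, for `k ≥ 2`, the ROTATED domain `D.rotate` — same sites, base dart the second marked dart of `D`,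
positions shifted by `pos 1` (the last one wrapping around the cycle) — and proves that every mark-indexed object shifts by one:
`D.rotate.markDart i = D.markDart (i + 1)`, `markSite`, the preceding dart `predDart`, the corner faces (`IsCornerFace`, `yc`, `corners`),
while the site-level objects (`verts`, `hBonds`, `triFacesTouching`, `AllSides`, the XOR spaces `loopSpaceX` / `TXb`) are unchanged and the
corner-indexed classes shift: `InClassX D.rotate u w s j ξ ↔ InClassX D u w s (j + 1) ξ`. Purpose: statements proved for ONE frame / one
mark index (e.g. the frame-`A₀` colouring transport `xiOf₃` of `KhSThreeDisorderObservable.lean`, or a boundary-value law on the stretch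
`A₀`) transfer to all marks by iterating `rotate`.

## References
* B. Bollobás, O. Riordan, *Percolation*, Cambridge University Press (2006), Ch. 7 §7.2.2 (marked discrete domains; printed pp. 191–193).
* M. Khristoforov, S. Smirnov, *Percolation and O(1) loop model*, arXiv:2111.15612 (2021), §2 Definition 3 (arXiv v1 p. 4: `u₁, u₂, u₃`
  in counterclockwise order — the cyclic symmetry of the marks).
-/

open Finset

namespace Literature.Probability.Percolation.TriMarkedDomain

open Literature.Probability.Percolation Literature.Probability.LatticeModels Literature.Probability.Percolation.MarkedLoops

variable {n : ℕ} (D : TriMarkedDomain (n + 2))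

/-! ## The shift and the rotated positions -/

/-- the shift: the position of the second mark along the boundary cycle. [cite: BollobasRiordan2006, Ch. 7 §7.2.2 (marked discrete domains, printed pp. 191–193)] -/
def rotShift : ℕ := D.pos 1

/-- the rotated positions: `pos (i + 1) − pos 1`, the last one wrapping around (`#∂ − pos 1`). [cite: BollobasRiordan2006, Ch. 7 §7.2.2 (marked discrete domains, printed pp. 191–193)] -/
noncomputable def rotPos (i : Fin (n + 2)) : ℕ := if i = Fin.last (n + 1) then D.bdryLen - D.rotShift else D.pos (i + 1) - D.rotShift

/-- `pos 0 = 0`. [folklore] -/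
private theorem pos_zero' : D.pos 0 = 0 := by
  rw [← Fin.mk_zero]; exact D.pos_zero (Nat.succ_pos _)

/-- the shift is positive (`pos 0 = 0 < pos 1`). [folklore] -/
private theorem rotShift_pos : 0 < D.rotShift := by
  unfold rotShift
  rw [← pos_zero' D]
  exact D.pos_strictMono (by rw [Fin.lt_def, Fin.val_zero, Fin.val_one]; exact Nat.zero_lt_one)

/-- the shift is a position on the cycle. [folklore] -/
private theorem rotShift_lt : D.rotShift < D.bdryLen := D.pos_lt 1

/-- the value of `i + 1` for `i` not the last index. [folklore] -/
private theorem val_add_one_of_ne_last {i : Fin (n + 2)} (h : i ≠ Fin.last (n + 1)) : ((i + 1 : Fin (n + 2)) : ℕ) = i + 1 := by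
  rw [Fin.val_add_one]
  simp [h]

/-- `pos 1 ≤ pos (i + 1)` for `i` not the last index. [folklore] -/
private theorem rotShift_le_pos_succ {i : Fin (n + 2)} (h : i ≠ Fin.last (n + 1)) : D.rotShift ≤ D.pos (i + 1) := by
  unfold rotShift
  refine D.pos_strictMono.monotone ?_
  rw [Fin.le_iff_val_le_val, val_add_one_of_ne_last h, Fin.val_one]
  exact Nat.le_add_left 1 _

/-- iterating the boundary successor is additive. [folklore] -/
private theorem iter_add' (d : Site 2 × Site 2) (m t : ℕ) :
    triBdryIter D.verts d (m + t) = triBdryIter D.verts (triBdryIter D.verts d m) t := by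
  rw [triBdryIter, triBdryIter, triBdryIter, Nat.add_comm m t, Function.iterate_add_apply]

/-- the boundary traversal from the base is periodic. [folklore] -/
private theorem iter_base_add_len (m : ℕ) : triBdryIter D.verts D.base (m + D.bdryLen) = triBdryIter D.verts D.base m := by
  rw [Nat.add_comm m D.bdryLen, iter_add']
  unfold bdryLen
  rw [D.cycle_len]

/-- iterating from the second marked dart = iterating from the base with the shift added. [folklore] -/
private theorem iter_markDart_one (m : ℕ) :
    triBdryIter D.verts (D.markDart 1) m = triBdryIter D.verts D.base (D.rotShift + m) := by
  unfold markDart rotShift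
  rw [iter_add']

/-- ★ the key computation: from the second marked dart, `rotPos i + t` steps reach `pos (i + 1) + t` steps from the base (for the last
index, `pos 0 + t = t` steps, around the cycle). [cite: BollobasRiordan2006, Ch. 7 §7.2.2 (marked discrete domains, printed pp. 191–193)] -/
theorem iter_rotPos_add (i : Fin (n + 2)) (t : ℕ) :
    triBdryIter D.verts (D.markDart 1) (D.rotPos i + t) = triBdryIter D.verts D.base (D.pos (i + 1) + t) := by
  rw [iter_markDart_one]
  unfold rotPos
  split_ifs with h
  · subst h
    rw [Fin.last_add_one, pos_zero' D, Nat.zero_add, ← Nat.add_assoc, Nat.add_sub_cancel' (rotShift_lt D).le,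
      Nat.add_comm D.bdryLen t, iter_base_add_len]
  · rw [← Nat.add_assoc, Nat.add_sub_cancel' (rotShift_le_pos_succ D h)]

/-- the same with `t = 0`: `rotPos i` steps from the second marked dart reach the `(i+1)`-st marked dart. [cite: BollobasRiordan2006, Ch. 7 §7.2.2 (marked discrete domains, printed pp. 191–193)] -/
theorem iter_rotPos (i : Fin (n + 2)) : triBdryIter D.verts (D.markDart 1) (D.rotPos i) = D.markDart (i + 1) := by
  have h := iter_rotPos_add D i 0
  simp only [Nat.add_zero] at h
  rw [h]
  rfl

/-! ## The rotated domain -/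

/-- ★ **the ROTATED `k`-marked domain** (`k ≥ 2`): the same sites, the boundary cycle re-based at the second marked dart, marks
`i ↦` old mark `i + 1`. [cite: BollobasRiordan2006, Ch. 7 §7.2.2 (marked discrete domains, printed pp. 191–193)] -/
noncomputable def rotate : TriMarkedDomain (n + 2) where
  verts := D.verts
  base := D.markDart 1
  pos := D.rotPos
  base_mem := triBdryIter_mem D.base_mem _
  connected := D.connected
  outer_connected := D.outer_connected
  no_cut := D.no_cut
  outer_no_cut := D.outer_no_cut
  euler := D.euler
  cycle := by
    intro d hd
    obtain ⟨m₀, hm₀, hd₀⟩ := D.cycle d hd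
    have hsl := rotShift_lt D
    unfold bdryLen at hsl
    by_cases h : D.rotShift ≤ m₀
    · refine ⟨m₀ - D.rotShift, lt_of_le_of_lt (Nat.sub_le _ _) hm₀, ?_⟩
      rw [iter_markDart_one, Nat.add_sub_cancel' h, hd₀]
    · replace h : m₀ < D.rotShift := not_le.1 h
      refine ⟨m₀ + #(triBdryDarts D.verts) - D.rotShift, by omega, ?_⟩
      rw [iter_markDart_one, show D.rotShift + (m₀ + #(triBdryDarts D.verts) - D.rotShift) = m₀ + #(triBdryDarts D.verts) by omega]
      have hp := iter_base_add_len D m₀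
      unfold bdryLen at hp
      rw [hp, hd₀]
  cycle_len := by
    show triBdryIter D.verts (D.markDart 1) #(triBdryDarts D.verts) = D.markDart 1
    rw [iter_markDart_one]
    have hp := iter_base_add_len D D.rotShift
    unfold bdryLen at hp
    rw [hp]
    rfl
  pos_zero := by
    intro h
    show D.rotPos ⟨0, h⟩ = 0
    unfold rotPos
    have hne : (⟨0, h⟩ : Fin (n + 2)) ≠ Fin.last (n + 1) := by
      rw [Ne, Fin.ext_iff, Fin.val_last]; exact (Nat.succ_ne_zero n).symm
    rw [if_neg hne, Fin.mk_zero, zero_add]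
    exact Nat.sub_self _
  pos_strictMono := by
    intro i j hij
    show D.rotPos i < D.rotPos j
    have hi : i ≠ Fin.last (n + 1) := fun h => by
      subst h; exact absurd (Fin.le_last j) (not_le.2 hij)
    unfold rotPos
    rw [if_neg hi]
    have h2 : D.rotShift ≤ D.pos (i + 1) := rotShift_le_pos_succ D hi
    by_cases hj : j = Fin.last (n + 1)
    · rw [if_pos hj]
      have h1 : D.pos (i + 1) < D.bdryLen := D.pos_lt (i + 1)
      omega
    · rw [if_neg hj]
      have h1 : D.pos (i + 1) < D.pos (j + 1) := D.pos_strictMono (by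
        rw [Fin.lt_def, val_add_one_of_ne_last hi, val_add_one_of_ne_last hj]
        exact Nat.succ_lt_succ (Fin.lt_def.1 hij))
      omega
  pos_lt := by
    intro i
    show D.rotPos i < #(triBdryDarts D.verts)
    have hsl := rotShift_lt D
    have hsp := rotShift_pos D
    unfold bdryLen at hsl
    unfold rotPos
    split_ifs with h
    · unfold bdryLen; omega
    · have := D.pos_lt (i + 1); omega
  mark_pred := by
    intro i
    show (triBdryIter D.verts (D.markDart 1) (D.rotPos i + (#(triBdryDarts D.verts) - 1))).1 =
      (triBdryIter D.verts (D.markDart 1) (D.rotPos i)).1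
    rw [iter_rotPos_add, iter_rotPos]
    exact D.mark_pred (i + 1)
  mark_pred_pred := by
    intro i
    show (triBdryIter D.verts (D.markDart 1) (D.rotPos i + (#(triBdryDarts D.verts) - 2))).1 ≠
      (triBdryIter D.verts (D.markDart 1) (D.rotPos i)).1
    rw [iter_rotPos_add, iter_rotPos]
    exact D.mark_pred_pred (i + 1)
  mark_injective := by
    intro i j h
    have h' : (triBdryIter D.verts (D.markDart 1) (D.rotPos i)).1 = (triBdryIter D.verts (D.markDart 1) (D.rotPos j)).1 := h
    rw [iter_rotPos, iter_rotPos] at h'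
    exact add_right_cancel (D.mark_injective h')

/-! ## Transport: mark-indexed objects shift by one, site-level objects are unchanged -/

/-- same sites. [cite: BollobasRiordan2006, Ch. 7 §7.2.2 (marked discrete domains, printed pp. 191–193)] -/
@[simp] theorem rotate_verts : D.rotate.verts = D.verts := rfl

/-- same boundary length. [cite: BollobasRiordan2006, Ch. 7 §7.2.2 (marked discrete domains, printed pp. 191–193)] -/
@[simp] theorem rotate_bdryLen : D.rotate.bdryLen = D.bdryLen := rfl

/-- ★ the marked darts shift by one. [cite: BollobasRiordan2006, Ch. 7 §7.2.2 (marked discrete domains, printed pp. 191–193)] -/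
@[simp] theorem rotate_markDart (i : Fin (n + 2)) : D.rotate.markDart i = D.markDart (i + 1) := iter_rotPos D i

/-- the marked sites shift by one. [cite: BollobasRiordan2006, Ch. 7 §7.2.2 (marked discrete domains, printed pp. 191–193)] -/
@[simp] theorem rotate_markSite (i : Fin (n + 2)) : D.rotate.markSite i = D.markSite (i + 1) := by
  unfold markSite
  rw [rotate_markDart]

/-- the boundary traversal of the rotated domain, measured from its marks, is the old one measured from the shifted marks.
[cite: BollobasRiordan2006, Ch. 7 §7.2.2 (marked discrete domains, printed pp. 191–193)] -/
theorem rotate_iter_pos_add (i : Fin (n + 2)) (t : ℕ) :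
    triBdryIter D.rotate.verts D.rotate.base (D.rotate.pos i + t) = triBdryIter D.verts D.base (D.pos (i + 1) + t) :=
  iter_rotPos_add D i t

/-- `i + 1` as a `Fin` literal, for `i` not the last index. [folklore] -/
private theorem mk_val_add_one {i : Fin (n + 2)} (h : i ≠ Fin.last (n + 1)) (h' : i.val + 1 < n + 2) :
    (⟨i.val + 1, h'⟩ : Fin (n + 2)) = i + 1 :=
  Fin.ext (by rw [val_add_one_of_ne_last h])

/-- the end of a rotated stretch, shifted back: `nextPos' i + pos 1 = nextPos (i + 1)` for `i` not the last index. [folklore] -/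
private theorem rotate_nextPos_of_ne_last {i : Fin (n + 2)} (h : i ≠ Fin.last (n + 1)) :
    D.rotate.nextPos i + D.rotShift = D.nextPos (i + 1) := by
  have h' : i.val + 1 < n + 2 := by
    have := Fin.val_lt_last h; omega
  have e1 : D.rotate.nextPos i = D.rotPos (i + 1) := by
    unfold nextPos
    rw [dif_pos h', mk_val_add_one h h']
    rfl
  rw [e1]
  unfold rotPos nextPos
  by_cases hl : i + 1 = Fin.last (n + 1)
  · rw [if_pos hl]
    have hv : ¬ ((i + 1 : Fin (n + 2)).val + 1 < n + 2) := by rw [hl, Fin.val_last]; omega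
    rw [dif_neg hv, Nat.sub_add_cancel (rotShift_lt D).le]
  · rw [if_neg hl]
    have hv : (i + 1 : Fin (n + 2)).val + 1 < n + 2 := Nat.succ_lt_succ (Fin.val_lt_last hl)
    rw [dif_pos hv, Nat.sub_add_cancel (rotShift_le_pos_succ D hl), mk_val_add_one hl hv]

/-- the end of the last rotated stretch is the cycle length. [folklore] -/
private theorem rotate_nextPos_last : D.rotate.nextPos (Fin.last (n + 1)) = D.bdryLen := by
  unfold nextPos
  rw [dif_neg (by rw [Fin.val_last]; omega)]
  rfl

/-- the first stretch of `D` ends at `pos 1`. [folklore] -/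
private theorem nextPos_zero : D.nextPos 0 = D.rotShift := by
  unfold nextPos rotShift
  rw [dif_pos (by rw [Fin.val_zero]; omega)]
  congr 1

/-- ★ the boundary stretches (arcs, as dart sets) shift by one: `A'_i = A_{i+1}` — the last one being `A_0`, reached around the cycle.
[cite: BollobasRiordan2006, Ch. 7 §7.2.2 (marked discrete domains and their arcs, printed pp. 191–193)] -/
theorem rotate_stretch (i : Fin (n + 2)) : D.rotate.stretch i = D.stretch (i + 1) := by
  ext d
  unfold stretch
  simp only [Finset.mem_image, Finset.mem_Ico]
  have hsl := rotShift_lt D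
  by_cases h : i = Fin.last (n + 1)
  · subst h
    rw [rotate_nextPos_last, Fin.last_add_one, pos_zero' D, nextPos_zero]
    constructor
    · rintro ⟨m, ⟨hm1, hm2⟩, rfl⟩
      have hm1' : D.bdryLen - D.rotShift ≤ m := by
        have : D.rotate.pos (Fin.last (n + 1)) = D.bdryLen - D.rotShift := if_pos rfl
        rw [← this]; exact hm1
      refine ⟨D.rotShift + m - D.bdryLen, ⟨Nat.zero_le _, by omega⟩, ?_⟩
      show triBdryIter D.verts D.base _ = triBdryIter D.verts (D.markDart 1) m
      rw [iter_markDart_one, ← iter_base_add_len D (D.rotShift + m - D.bdryLen), Nat.sub_add_cancel (by omega)]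
    · rintro ⟨m, ⟨-, hm2⟩, rfl⟩
      refine ⟨D.bdryLen - D.rotShift + m, ⟨le_of_eq_of_le (if_pos rfl) (Nat.le_add_right _ _), by omega⟩, ?_⟩
      show triBdryIter D.verts (D.markDart 1) _ = triBdryIter D.verts D.base m
      rw [iter_markDart_one, ← Nat.add_assoc, Nat.add_sub_cancel' hsl.le, Nat.add_comm D.bdryLen m, iter_base_add_len]
  · have hnp := rotate_nextPos_of_ne_last D h
    have hrp : D.rotate.pos i = D.pos (i + 1) - D.rotShift := if_neg h
    have hle := rotShift_le_pos_succ D h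
    constructor
    · rintro ⟨m, ⟨hm1, hm2⟩, rfl⟩
      refine ⟨D.rotShift + m, ⟨by rw [hrp] at hm1; omega, by omega⟩, ?_⟩
      show triBdryIter D.verts D.base _ = triBdryIter D.verts (D.markDart 1) m
      rw [iter_markDart_one]
    · rintro ⟨m, ⟨hm1, hm2⟩, rfl⟩
      refine ⟨m - D.rotShift, ⟨by rw [hrp]; omega, by omega⟩, ?_⟩
      show triBdryIter D.verts (D.markDart 1) _ = triBdryIter D.verts D.base m
      rw [iter_markDart_one, Nat.add_sub_cancel' (le_trans hle hm1)]

/-- the arcs `A_i ⊆ ∂⁻G` shift by one. [cite: BollobasRiordan2006, Ch. 7 §7.2.2 (marked discrete domains and their arcs, printed pp. 191–193)] -/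
theorem rotate_arc (i : Fin (n + 2)) : D.rotate.arc i = D.arc (i + 1) := by
  unfold arc; rw [rotate_stretch]

/-- the outer arcs `A_i⁺ ⊆ ∂⁺G` shift by one. [cite: BollobasRiordan2006, Ch. 7 §7.2.2 (marked discrete domains and their arcs, printed pp. 191–193)] -/
theorem rotate_outerArc (i : Fin (n + 2)) : D.rotate.outerArc i = D.outerArc (i + 1) := by
  unfold outerArc; rw [rotate_stretch]

/-- the darts preceding the marks shift by one. [cite: BollobasRiordan2006, Ch. 7 §7.2.2 (marked discrete domains, printed pp. 191–193)] -/
@[simp] theorem rotate_predDart (i : Fin (n + 2)) : predDart D.rotate i = predDart D (i + 1) := by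
  unfold predDart
  rw [rotate_bdryLen]
  exact iter_rotPos_add D i _

/-- the corner faces shift by one. [cite: BollobasRiordan2006, Ch. 7 §7.2.2 (marked discrete domains, printed pp. 191–193)] -/
theorem rotate_isCornerFace (i : Fin (n + 2)) (F : HexVertex) : IsCornerFace D.rotate i F ↔ IsCornerFace D (i + 1) F := by
  unfold IsCornerFace
  rw [rotate_markSite, rotate_markDart, rotate_predDart]

/-- «being some corner face» is rotation invariant. [cite: BollobasRiordan2006, Ch. 7 §7.2.2 (marked discrete domains, printed pp. 191–193)] -/
theorem rotate_exists_isCornerFace (F : HexVertex) : (∃ i, IsCornerFace D.rotate i F) ↔ ∃ i, IsCornerFace D i F := by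
  constructor
  · rintro ⟨i, h⟩; exact ⟨i + 1, (rotate_isCornerFace D i F).1 h⟩
  · rintro ⟨i, h⟩; exact ⟨i - 1, (rotate_isCornerFace D (i - 1) F).2 (by rw [sub_add_cancel]; exact h)⟩

/-- the corner faces `y_i` shift by one. [cite: BollobasRiordan2006, Ch. 7 §7.2.2 (marked discrete domains, printed pp. 191–193)] -/
@[simp] theorem rotate_yc (i : Fin (n + 2)) : yc D.rotate i = yc D (i + 1) := by
  have h := yc_spec D.rotate i
  rw [rotate_isCornerFace] at h
  exact (isCornerFace_iff_eq_yc D).1 h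

/-- the set of corner faces is rotation invariant. [cite: BollobasRiordan2006, Ch. 7 §7.2.2 (marked discrete domains, printed pp. 191–193)] -/
@[simp] theorem rotate_corners : corners D.rotate = corners D := by
  ext F
  rw [mem_corners, mem_corners]
  constructor
  · rintro ⟨i, rfl⟩; exact ⟨i + 1, rotate_yc D i⟩
  · rintro ⟨i, rfl⟩; exact ⟨i - 1, by rw [rotate_yc, sub_add_cancel]⟩

/-- the bonds of `H_G` are rotation invariant (they depend on the sites only). [cite: KhristoforovSmirnov2021, §1.2 (loop configurations, arXiv v1 pp. 2–3)] -/
@[simp] theorem rotate_hBonds : hBonds D.rotate = hBonds D := rfl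

/-- «all three sides in `H_G`» is rotation invariant. [cite: KhristoforovSmirnov2021, §2 Lemma 4 (arXiv v1 p. 4)] -/
theorem rotate_allSides (v : HexVertex) : AllSides D.rotate v ↔ AllSides D v := Iff.rfl

/-- the XOR space at a bond is rotation invariant. [cite: KhristoforovSmirnov2021, §1.2 (loop configurations, arXiv v1 pp. 2–3)] -/
@[simp] theorem rotate_loopSpaceX (u w : Site 2) (s : HexVertex) : loopSpaceX D.rotate u w s = loopSpaceX D u w s := by
  classical
  unfold loopSpaceX
  rw [rotate_hBonds, rotate_verts]
  refine Finset.filter_congr fun ξ _ => forall₂_congr fun F _ => ?_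
  rw [rotate_exists_isCornerFace]

/-- the XOR space at the `i`-th side of `v` is rotation invariant. [cite: KhristoforovSmirnov2021, §1.2 (loop configurations, arXiv v1 pp. 2–3)] -/
@[simp] theorem rotate_TXb (v : HexVertex) (i : Fin 3) (s : HexVertex) : TXb D.rotate v i s = TXb D v i s := by
  unfold TXb
  rw [rotate_loopSpaceX]

/-- ★ the link-pattern classes shift by one: «linked to corner `j` of the rotated domain» = «linked to corner `j + 1`».
[cite: KhristoforovSmirnov2021, §2 Definition 3 (arXiv v1 p. 4)] -/
theorem rotate_inClassX (u w : Site 2) (s : HexVertex) (j : Fin (n + 2)) (ξ : Finset (Sym2 (Site 2))) :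
    InClassX D.rotate u w s j ξ ↔ InClassX D u w s (j + 1) ξ := by
  unfold InClassX
  rw [rotate_loopSpaceX]
  simp only [rotate_isCornerFace]

end Literature.Probability.Percolation.TriMarkedDomain

/-! ## Three marks: the observable's classes shift by one -/

namespace Literature.Probability.Percolation.MarkedLoops

open Literature.Probability.Percolation Literature.Probability.LatticeModels TriMarkedDomain

variable (D : TriMarkedDomain 3)

open Classical in
/-- the class counts shift: `N_j` of the rotated domain is `N_{j+1}`. [cite: KhristoforovSmirnov2021, §2 Definition 3 (arXiv v1 p. 4)] -/
theorem rotate_classCount (v : HexVertex) (i j : Fin 3) : classCount D.rotate v i j = classCount D v i (j + 1) := by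
  unfold classCount
  rw [rotate_TXb, rotate_TXb,
    Finset.filter_congr (s := TXb D v i v) (fun ξ _ => rotate_inClassX D (faceVertex v (i + 1)) (faceVertex v (i + 2)) v j ξ),
    Finset.filter_congr (s := TXb D v i (oppFace v i))
      (fun ξ _ => rotate_inClassX D (faceVertex v (i + 1)) (faceVertex v (i + 2)) (oppFace v i) j ξ)]

/-- `H_j` of the rotated domain is `H_{j+1}`. [cite: KhristoforovSmirnov2021, §2 Definition 3 (arXiv v1 p. 4)] -/
theorem rotate_hobs (v : HexVertex) (i j : Fin 3) : Hobs D.rotate v i j = Hobs D v i (j + 1) := by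
  unfold Hobs
  rw [rotate_classCount, rotate_verts]

end Literature.Probability.Percolation.MarkedLoops
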